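import Summits.KontsevichZagierPeriods.KontsevichZagierPeriods.Theorems.RootDecompRelativeModAbsoluteEvenCircleP3

/-! # `RootDecompRelativeModAbsoluteEvenCircleP4` — part 4/10 of the mechanical ≤400-line split of `evB_src3.lean` (sha256 9b9fc462830f2800…)
Source: decomp-kz lens-3 g14 EvenCircle.lean FINAL @ba0f3b57 §K0–§K12 (land/EvenCircleB @954ab641, lint-fixed, §K12 re-pointed at the landed CircleSplit names; critic CLEARED g7-2 l.1388: evenCircleCellClose_holds); --supports stmt-KontsevichZagierPeriods-30572.
Split by census-1 g10 `gen/splitlean.py`: scopes re-opened with their `open`/`variable`/`set_option` context; mathematics and declaration order unchanged. -/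

noncomputable section
open Set MeasureTheory
open Literature.NumberTheory.Transcendental Literature.ModelTheory.ExponentialFields
namespace Summit.KontsevichZagierPeriods.RootDecompRelativeModAbsolute.Rung30571.RegularisedLogLayer.CylLog.Leaf.G13
open Set MeasureTheory in
open Literature.NumberTheory.Transcendental Literature.ModelTheory.ExponentialFields in
/-- Auxiliary step `init_apply_zero` (§B2): init apply zero. [bookkeeping] -/
private theorem init_apply_zero (z : Fin 2 → ℝ) : Fin.init z 0 = z 0 := rfl

namespace AngleFold

/-- **Increasing circle piece (PROVED).** As `dec_piece_circ` but for `u` increasing and bounded on `T`: with `d = sup_T u`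
(an algebraic number), `cl A = cl K − cl W`, `K = ⟦band T 0 d; p g_n⟧` (honest because `p ∈ L¹(T)`), `W = ⟦Rgn T; wcirc p u n⟧`. -/
theorem inc_piece_circ {T : Set (Fin 1 → ℝ)} (hT : IsSemialgebraic ℚ T) (hTo : IsOpen T) (hTc : OrdConv T)
    (hne : T.Nonempty) (n : ℕ) {p u : (Fin 1 → ℝ) → ℝ} (hp : IsSemialgebraicFunOn ℚ T p) (hu : IsSemialgebraicFunOn ℚ T u)
    (hu0 : ∀ x ∈ T, 0 ≤ u x) (hud : ∀ x ∈ T, DifferentiableAt ℝ u x) (hdu : ∀ x ∈ T, 0 < du u x)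
    (hbdd : BddAbove (u '' T)) (hpi : IntegrableOn p T)
    (A : KZ.IntegralRep 2) (hAd : A.domain = KZlog.band T (fun _ => 0) u)
    (hAi : EqOn A.integrand (fun z => p (Fin.init z) * gk n (z (Fin.last 1))) A.domain) :
    ∃ (d : ℝ) (K W : KZ.IntegralRep 2), 0 ≤ d ∧ SaConst T d ∧
      K.domain = KZlog.band T (fun _ => 0) (fun _ => d) ∧
      K.integrand = (fun z => p (Fin.init z) * gk n (z (Fin.last 1))) ∧
      W.domain = Rgn T ∧ W.integrand = wcirc p u n ∧
      cl A = cl K - cl W ∧ (∀ x ∈ T, u x < d) ∧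
      ∀ δ > 0, ∃ x₁ ∈ T, ∀ x ∈ T, x₁ 0 ≤ x 0 → |u x - d| < δ := by
  have hTm : MeasurableSet T := IsSemialgebraic.measurableSet_holds hT
  set uR : ℝ → ℝ := fun s => u (bpt s) with huR
  have hderR : ∀ s ∈ bpt ⁻¹' T, HasDerivAt uR (du u (bpt s)) s := fun s hs => hasDerivAt_comp_bpt (hud _ hs)
  have hcontR : ContinuousOn uR (bpt ⁻¹' T) := fun s hs => (hderR s hs).continuousAt.continuousWithinAt
  have hmono : StrictMonoOn uR (bpt ⁻¹' T) := strictMonoOn_of_du_pos hTo hTc hud hdu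
  have hlt_of_lt : ∀ x ∈ T, ∀ y ∈ T, x 0 < y 0 → u x < u y := fun x hx y hy hxy => by
    have := hmono (mem_preimage_bpt hx) (mem_preimage_bpt hy) hxy
    simpa only [huR, bpt_apply_zero] using this
  have hle_of_le : ∀ x ∈ T, ∀ y ∈ T, x 0 ≤ y 0 → u x ≤ u y := fun x hx y hy hxy => by
    have := hmono.monotoneOn (mem_preimage_bpt hx) (mem_preimage_bpt hy) hxy
    simpa only [huR, bpt_apply_zero] using this
  -- the supremum `d`
  set D : Set ℝ := u '' T with hD
  have hDne : D.Nonempty := hne.image u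
  set d := sSup D with hd
  have hdle : ∀ x ∈ T, u x ≤ d := fun x hx => le_csSup hbdd ⟨x, hx, rfl⟩
  have hdlt : ∀ x ∈ T, u x < d := fun x hx => by
    obtain ⟨y, hy, hxy⟩ := exists_mem_gt hTo hx
    exact (hlt_of_lt x hx y hy hxy).trans_le (hdle y hy)
  obtain ⟨x₀, hx₀⟩ := hne
  have hd0 : 0 ≤ d := (hu0 x₀ hx₀).trans (hdle x₀ hx₀)
  have happ : ∀ t, t < d → ∃ x ∈ T, t < u x := fun t ht => by
    obtain ⟨_, ⟨x, hx, rfl⟩, hlt⟩ := exists_lt_of_lt_csSup hDne ht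
    exact ⟨x, hx, hlt⟩
  have hdalg : IsAlgebraic ℚ d := by
    have h := isAlgebraic_of_order_frontier hT hu.neg (d := -d) (fun x hx => by
      have := hdlt x hx; show -d < -u x; linarith) fun ε hε => by
      obtain ⟨x, hx, h⟩ := happ (d - ε) (by linarith)
      exact ⟨x, hx, by show -u x < -d + ε; linarith⟩
    simpa using h.neg
  have hds : SaConst T d := saConst_of_isAlgebraic hT hdalg
  -- the constant monomial `K` (the big band)
  have hKint : IntegrableOn (fun x => p x * Gn n d) T := hpi.mul_const _
  let K : KZ.IntegralRep 2 := circRep hT hds hp n (fun _ _ => hd0) hKint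
  have hKd : K.domain = KZlog.band T (fun _ => 0) (fun _ => d) := rfl
  have hKi : K.integrand = fun z => p (Fin.init z) * gk n (z (Fin.last 1)) := rfl
  -- the substitution data on `Rgn T`
  set ψ : (Fin 2 → ℝ) → ℝ := fun z => u (bpt (z (Fin.last 1))) with hψ
  set ψs : (Fin 2 → ℝ) → ℝ := fun z => du u (bpt (z (Fin.last 1))) with hψs
  have hRsa : IsSemialgebraic ℚ (Rgn T) := isSemialgebraic_Rgn hT
  have hRm : MeasurableSet (Rgn T) := IsSemialgebraic.measurableSet_holds hRsa
  have hR2 : Rgn T ⊆ {z | bpt (z (Fin.last 1)) ∈ T} := fun z hz => hz.2.1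
  have hψsa : IsSemialgebraicFunOn ℚ (Rgn T) ψ := (sa_comp_bpt hu (Fin.last 1)).mono hR2 hRsa
  have hψd : ∀ z ∈ Rgn T, DifferentiableAt ℝ ψ z := fun z hz => by
    have h1 : DifferentiableAt ℝ (fun z : Fin 2 → ℝ => bpt (z (Fin.last 1))) z :=
      differentiableAt_pi.2 fun _ => differentiableAt_apply (Fin.last 1) z
    exact (hud _ hz.2.1).comp z h1
  have hψs' : ∀ z ∈ Rgn T, HasDerivAt (fun t : ℝ => ψ (Fin.snoc (Fin.init z) t)) (ψs z) (z (Fin.last 1)) :=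
    fun z hz => by
    have hfun : (fun t : ℝ => ψ (Fin.snoc (Fin.init z) t)) = uR := by
      funext t; simp only [hψ, huR, Fin.snoc_last]
    rw [hfun]
    exact hderR _ hz.2.1
  have hinj : ∀ z₁ ∈ Rgn T, ∀ z₂ ∈ Rgn T, Fin.init z₁ = Fin.init z₂ → ψ z₁ = ψ z₂ →
      z₁ (Fin.last 1) = z₂ (Fin.last 1) := fun z₁ h₁ z₂ h₂ _ he => hmono.injOn h₁.2.1 h₂.2.1 he
  -- the image `P = {u(x) < s < d}`
  set P : Set (Fin 2 → ℝ) := {w | Fin.init w ∈ T ∧ u (Fin.init w) < w (Fin.last 1) ∧ w (Fin.last 1) < d} with hP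
  have himage : substMap ψ '' Rgn T = P := by
    ext w
    constructor
    · rintro ⟨z, hz, rfl⟩
      refine ⟨by rw [init_substMap]; exact hz.1, ?_, by rw [substMap_last]; exact hdlt _ hz.2.1⟩
      rw [substMap_last, init_substMap]
      exact hlt_of_lt (Fin.init z) hz.1 (bpt (z (Fin.last 1))) hz.2.1
        (by rw [init_apply_zero, bpt_apply]; exact hz.2.2)
    · rintro ⟨hx, hut, htd⟩
      obtain ⟨y, hy, hyt⟩ := happ _ htd
      have hxy : Fin.init w 0 < y 0 := by
        by_contra hle
        push Not at hle
        have := hle_of_le y hy (Fin.init w) hx hle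
        linarith
      have hIcc : Icc (Fin.init w 0) (y 0) ⊆ bpt ⁻¹' T := fun s hs => hTc _ hx _ hy s hs.1 hs.2
      have hivt := intermediate_value_Ioo hxy.le (hcontR.mono hIcc)
      have ht : w (Fin.last 1) ∈ Ioo (uR (Fin.init w 0)) (uR (y 0)) := by
        simp only [huR, bpt_apply_zero]; exact ⟨hut, hyt⟩
      obtain ⟨ξ, hξ, hξt⟩ := hivt ht
      have hξT : bpt ξ ∈ T := hIcc (Ioo_subset_Icc_self hξ)
      have h0 : (Fin.snoc (Fin.init w) ξ : Fin 2 → ℝ) 0 = Fin.init w 0 := by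
        rw [show (0 : Fin 2) = Fin.castSucc (0 : Fin 1) from rfl, Fin.snoc_castSucc]
      refine ⟨Fin.snoc (Fin.init w) ξ, ⟨by rw [Fin.init_snoc]; exact hx, by rw [Fin.snoc_last]; exact hξT,
        by rw [Fin.snoc_last, h0]; exact hξ.1⟩, ?_⟩
      rw [substMap_apply, Fin.init_snoc]
      simp only [hψ, Fin.snoc_last]
      rw [show u (bpt ξ) = w (Fin.last 1) from hξt, Fin.snoc_init_self]
  -- the piece `Prep = K ∣ P`
  have hPK : P ⊆ K.domain := fun w hw =>
    ⟨hw.1, (hu0 _ hw.1).trans hw.2.1.le, hw.2.2.le⟩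
  have hB : IsSemialgebraic ℚ {w : Fin 2 → ℝ | Fin.init w ∈ T} := isSemialgebraic_initMem hT
  have hPsa : IsSemialgebraic ℚ P := by
    have hc : IsSemialgebraicFunOn ℚ {w : Fin 2 → ℝ | Fin.init w ∈ T} (fun _ => d) := saConst_of_isAlgebraic hB hdalg
    have hl : IsSemialgebraicFunOn ℚ {w : Fin 2 → ℝ | Fin.init w ∈ T} (fun w => w (Fin.last 1)) :=
      Literature.NumberTheory.Transcendental.isSemialgebraicFunOn_apply hB (Fin.last 1)
    have hs1 : IsSemialgebraicFunOn ℚ {w : Fin 2 → ℝ | Fin.init w ∈ T} (fun w => u (Fin.init w) - w (Fin.last 1)) :=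
      IsSemialgebraicFunOn.sub_holds hu.comp_init hl
    have hs2 : IsSemialgebraicFunOn ℚ {w : Fin 2 → ℝ | Fin.init w ∈ T} (fun w => w (Fin.last 1) - d) :=
      IsSemialgebraicFunOn.sub_holds hl hc
    have h1 := hs1.isSemialgebraic_sep_neg
    have h2 := hs2.isSemialgebraic_sep_neg
    have hPeq : P = {w | w ∈ {w : Fin 2 → ℝ | Fin.init w ∈ T} ∧ (fun w => u (Fin.init w) - w (Fin.last 1)) w < 0} ∩
        {w | w ∈ {w : Fin 2 → ℝ | Fin.init w ∈ T} ∧ (fun w => w (Fin.last 1) - d) w < 0} := by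
      ext w
      simp only [hP, mem_setOf_eq, mem_inter_iff]
      constructor
      · rintro ⟨hx, h1, h2⟩; exact ⟨⟨hx, by linarith⟩, ⟨hx, by linarith⟩⟩
      · rintro ⟨⟨hx, h1⟩, ⟨_, h2⟩⟩; exact ⟨hx, by linarith, by linarith⟩
    rw [hPeq]
    exact h1.inter h2
  have hPm : MeasurableSet P := IsSemialgebraic.measurableSet_holds hPsa
  set g : (Fin 2 → ℝ) → ℝ := fun w => p (Fin.init w) * gk n (w (Fin.last 1)) with hg
  have hgsa : IsSemialgebraicFunOn ℚ P g := sa_circKernel hPsa (fun w hw => hw.1) hp n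
  have hgint : IntegrableOn g P := K.integrableOn.mono_set hPK
  let Prep : KZ.IntegralRep 2 := ⟨P, g, hPsa, hgsa, hgint⟩
  -- the Jacobian monomial `W` on `Rgn T`
  have hwint : IntegrableOn (wcirc p u n) (Rgn T) := by
    have h1 : IntegrableOn g (substMap ψ '' Rgn T) := by rw [himage]; exact hgint
    rw [integrableOn_image_substMap_iff hRm ψ ψs hψd hψs' hinj g] at h1
    refine h1.congr_fun (fun z hz => ?_) hRm
    simp only [hψs, hg, init_substMap, substMap_last, hψ, wcirc]
    rw [abs_of_pos (hdu _ hz.2.1)]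
    ring
  have hwsa : IsSemialgebraicFunOn ℚ (Rgn T) (wcirc p u n) := sa_wcirc hT hTo n hp hu hud
  let W : KZ.IntegralRep 2 := ⟨Rgn T, wcirc p u n, hRsa, hwsa, hwint⟩
  -- the relations
  have r1 : KZ.of W - KZ.of Prep ∈ KZ.relations := by
    refine of_sub_of_mem_relations_of_subst ψ ψs W Prep hψsa hψd hψs' hinj himage.symm fun z hz => ?_
    show wcirc p u n z = g (substMap ψ z) * |ψs z|
    simp only [hg, hψs, hψ, wcirc, init_substMap, substMap_last]
    rw [abs_of_pos (hdu _ hz.2.1)]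
  have hAK : A.domain ⊆ K.domain := fun w hw => by
    rw [hAd] at hw; exact ⟨hw.1, hw.2.1, hw.2.2.trans (hdle _ hw.1)⟩
  have hSsa : IsSemialgebraic ℚ (A.domain ∪ P) := A.isSemialgebraic_domain.union hPsa
  have hSK : A.domain ∪ P ⊆ K.domain := union_subset hAK hPK
  have hvol : volume (K.domain \ (A.domain ∪ P)) = 0 := by
    refine measure_mono_null (fun w hw => ?_) (KZ.volume_setOf_last_eq_zero (n := 1) d)
    obtain ⟨⟨hx, h0, hle⟩, hnot⟩ := hw
    simp only [mem_union, not_or] at hnot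
    show w (Fin.last 1) = d
    refine le_antisymm hle ?_
    by_contra hlt
    push Not at hlt
    by_cases hut : w (Fin.last 1) ≤ u (Fin.init w)
    · exact hnot.1 (by rw [hAd]; exact ⟨hx, h0, hut⟩)
    · exact hnot.2 ⟨hx, lt_of_not_ge hut, hlt⟩
  have r2 : KZ.of K - KZ.of (K.restrict _ hSsa hSK) ∈ KZ.relations :=
    K.of_sub_of_restrict_mem_relations hSsa hSK hvol
  have r3 : KZ.of (K.restrict _ hSsa hSK) - KZ.of A - KZ.of Prep ∈ KZ.relations := by
    refine KZ.domainAddRel_subset_relations ⟨2, K.restrict _ hSsa hSK, A, Prep, rfl, ?_, ?_, ?_, rfl⟩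
    · have : A.domain ∩ P = ∅ := by
        ext w
        simp only [mem_inter_iff, mem_empty_iff_false, iff_false, not_and]
        intro hA hPw
        rw [hAd] at hA
        exact absurd hPw.2.1 (not_lt.2 hA.2.2)
      show volume (A.domain ∩ P) = 0
      rw [this]; exact measure_empty
    · exact fun w hw => (hAi hw).symm
    · exact fun w hw => rfl
  -- in the quotient
  have e1 : cl K = cl (K.restrict _ hSsa hSK) := mk_sub_eq r2
  have e2 : cl (K.restrict _ hSsa hSK) = cl A + cl Prep := by
    rw [sub_sub] at r3
    have := mk_sub_eq r3
    rwa [map_add] at this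
  have e3 : cl W = cl Prep := mk_sub_eq r1
  refine ⟨d, K, W, hd0, hds, hKd, hKi, rfl, rfl, ?_, hdlt, ?_⟩
  · rw [e1, e2, ← e3]; abel
  · intro δ hδ
    obtain ⟨x₁, hx₁, hux₁⟩ := happ (d - δ) (by linarith)
    refine ⟨x₁, hx₁, fun x hx hle => ?_⟩
    have h1 := hle_of_le x₁ hx₁ x hx hle
    have h2 := hdlt x hx
    rw [abs_of_neg (by linarith)]
    linarith

/-! ### §K5 Kernel division `g_n = q_n + (−1)^n/(1+s²)` as representations, honest polynomial bands, and KZ rule 3 in `s`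
for the polynomial part (regimes (a)/(c) and the constant bands of STEP 5). -/

/-- Auxiliary step `abs_qk_le` (§K5): abs qk le. [bookkeeping] -/
theorem abs_qk_le (n : ℕ) (t : ℝ) : |qk n t| ≤ gk n t + 1 / (1 + t ^ 2) := by
  have h : qk n t = gk n t - (-1) ^ n / (1 + t ^ 2) := by rw [gk_eq]; ring
  have h1 : |(-1 : ℝ) ^ n / (1 + t ^ 2)| = 1 / (1 + t ^ 2) := by
    rw [abs_div, abs_pow, abs_neg, abs_one, one_pow, abs_of_pos (by positivity)]
  rw [h]
  calc |gk n t - (-1) ^ n / (1 + t ^ 2)| ≤ |gk n t| + |(-1 : ℝ) ^ n / (1 + t ^ 2)| := abs_sub _ _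
    _ = gk n t + 1 / (1 + t ^ 2) := by rw [abs_of_nonneg (gk_nonneg n t), h1]

/-- Auxiliary step `continuous_qk` (§K5): continuous qk. [bookkeeping] -/
theorem continuous_qk (n : ℕ) : Continuous (qk n) := by
  induction n with
  | zero => simpa [qk] using continuous_const
  | succ n ih =>
    have h : Continuous fun s : ℝ => s ^ (2 * n) - qk n s := (continuous_pow (2 * n)).sub ih
    exact h.congr fun s => by simp [qk]

/-- Fibre bound for the polynomial kernel: `∫⁻_{[0,c]} ‖q q_n(t)‖ ≤ ‖q (G_n(c) + arctan c)‖` (`c ≥ 0`). -/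
theorem lintegral_polyKernel_le (q : ℝ) (n : ℕ) {c : ℝ} (hc : 0 ≤ c) :
    ∫⁻ t in Icc 0 c, ‖q * qk n t‖ₑ ≤ ‖q * (Gn n c + Real.arctan c)‖ₑ := by
  have hcont : ContinuousOn (fun t : ℝ => q * qk n t) (Icc 0 c) :=
    (continuous_const.mul (continuous_qk n)).continuousOn
  have hg_int : IntegrableOn (fun t : ℝ => q * qk n t) (Icc 0 c) := hcont.integrableOn_compact isCompact_Icc
  have hL : ∫⁻ t in Icc 0 c, ‖q * qk n t‖ₑ = ENNReal.ofReal (∫ t in Icc 0 c, ‖q * qk n t‖) :=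
    (ofReal_integral_norm_eq_lintegral_enorm hg_int).symm
  have hG0 : 0 ≤ Gn n c + Real.arctan c := add_nonneg (Gn_nonneg n hc) (Real.arctan_nonneg.2 hc)
  have hK0 : 0 ≤ |q| * (Gn n c + Real.arctan c) := mul_nonneg (abs_nonneg _) hG0
  rw [hL, show ‖q * (Gn n c + Real.arctan c)‖ₑ = ENNReal.ofReal (|q| * (Gn n c + Real.arctan c)) by
    rw [← Real.enorm_eq_ofReal hK0]
    simp [enorm_mul, Real.enorm_eq_ofReal_abs, abs_of_nonneg hG0]]
  refine ENNReal.ofReal_le_ofReal ?_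
  have hdom_cont : ContinuousOn (fun t : ℝ => |q| * (gk n t + 1 / (1 + t ^ 2))) (Icc 0 c) :=
    (continuous_const.mul ((continuous_gk n).add (continuous_const.div (by fun_prop) fun t => by positivity))).continuousOn
  have hdom_int : IntegrableOn (fun t : ℝ => |q| * (gk n t + 1 / (1 + t ^ 2))) (Icc 0 c) :=
    hdom_cont.integrableOn_compact isCompact_Icc
  calc ∫ t in Icc 0 c, ‖q * qk n t‖ ≤ ∫ t in Icc 0 c, |q| * (gk n t + 1 / (1 + t ^ 2)) := by
        refine setIntegral_mono_on hg_int.norm hdom_int measurableSet_Icc fun t _ => ?_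
        rw [Real.norm_eq_abs, abs_mul]
        exact mul_le_mul_of_nonneg_left (abs_qk_le n t) (abs_nonneg _)
    _ = |q| * (Gn n c + Real.arctan c) := by
        rw [integral_Icc_eq_integral_Ioc, ← intervalIntegral.integral_of_le hc, intervalIntegral.integral_const_mul]
        have hc1 : Continuous fun t : ℝ => 1 / (1 + t ^ 2) := continuous_const.div (by fun_prop) fun t => by positivity
        have hadd : ∫ x in (0:ℝ)..c, (gk n x + 1 / (1 + x ^ 2)) = (∫ x in (0:ℝ)..c, gk n x) + ∫ x in (0:ℝ)..c, 1 / (1 + x ^ 2) :=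
          intervalIntegral.integral_add ((continuous_gk n).intervalIntegrable _ _) (hc1.intervalIntegrable _ _)
        have hat : ∫ x in (0:ℝ)..c, 1 / (1 + x ^ 2) = Real.arctan c := by
          rw [intervalIntegral.integral_eq_sub_of_hasDerivAt (fun x _ => Real.hasDerivAt_arctan x)
            (hc1.intervalIntegrable _ _), Real.arctan_zero, sub_zero]
        rw [hadd, hat]
        rfl

/-- Auxiliary step `sa_qk` (§K5): sa qk. [bookkeeping] -/
theorem sa_qk {m : ℕ} {S : Set (Fin m → ℝ)} (hS : IsSemialgebraic ℚ S) {v : (Fin m → ℝ) → ℝ}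
    (hv : IsSemialgebraicFunOn ℚ S v) (n : ℕ) : IsSemialgebraicFunOn ℚ S (fun z => qk n (v z)) := by
  induction n with
  | zero => exact (isSemialgebraicFunOn_ratCast hS 0).congr fun _ _ => by simp [qk]
  | succ n ih => exact (IsSemialgebraicFunOn.sub_holds (hv.fun_pow (2 * n)) ih).congr fun _ _ => by simp [qk]

/-- **Honesty of a polynomial band** `[band G 0 u, q·q_n(t)]` from `q·G_n(u), q·arctan(u) ∈ L¹(G)`. -/
theorem integrableOn_polyKernel_band {m : ℕ} {G : Set (Fin m → ℝ)} {u q : (Fin m → ℝ) → ℝ}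
    (hG : IsSemialgebraic ℚ G) (hu : IsSemialgebraicFunOn ℚ G u) (hq : IsSemialgebraicFunOn ℚ G q) (n : ℕ)
    (hu0 : ∀ y ∈ G, 0 ≤ u y) (hint : IntegrableOn (fun y => q y * Gn n (u y)) G)
    (hqa : IntegrableOn (fun y => q y * Real.arctan (u y)) G) :
    IntegrableOn (fun z : Fin (m + 1) → ℝ => q (Fin.init z) * qk n (z (Fin.last m)))
      (KZlog.band G (fun _ => 0) u) := by
  have h0sa : IsSemialgebraicFunOn ℚ G (fun _ => (0:ℝ)) := (isSemialgebraicFunOn_ratCast hG 0).congr fun _ _ => by simp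
  have hbsa : IsSemialgebraic ℚ (KZlog.band G (fun _ => (0:ℝ)) u) := KZlog.isSemialgebraic_band h0sa hu
  have hGm : MeasurableSet G := hG.measurableSet_holds
  have hBm : MeasurableSet (KZlog.band G (fun _ => (0:ℝ)) u) := hbsa.measurableSet_holds
  have hl : IsSemialgebraicFunOn ℚ (KZlog.band G (fun _ => (0:ℝ)) u) (fun z => z (Fin.last m)) :=
    Literature.NumberTheory.Transcendental.isSemialgebraicFunOn_apply hbsa (Fin.last m)
  have hRsa : IsSemialgebraicFunOn ℚ (KZlog.band G (fun _ => (0:ℝ)) u)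
      (fun z => q (Fin.init z) * qk n (z (Fin.last m))) := (hq.comp_init.mono (fun z hz => hz.1) hbsa).mul_holds (sa_qk hbsa hl n)
  refine KZlog.integrableOn_band_of_lintegral_fibre_le hGm (a := fun _ => (0:ℝ)) (b := u) hBm
    (fun x t => KZlog.snoc_mem_band) (KZ.aestronglyMeasurable_of_isSemialgebraicFunOn hRsa hBm)
    (K := fun x => q x * (Gn n (u x) + Real.arctan (u x))) (fun x hx => ?_) ?_
  · simp only [Fin.init_snoc, Fin.snoc_last]
    exact lintegral_polyKernel_le (q x) n (hu0 x hx)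
  · exact (hint.add hqa).congr_fun (fun x _ => by simp only [Pi.add_apply]; ring) hGm

/-- The honest polynomial band `[band G 0 u, q·q_n(t)]`. -/
def polyRep {m : ℕ} {G : Set (Fin m → ℝ)} {u q : (Fin m → ℝ) → ℝ}
    (hG : IsSemialgebraic ℚ G) (hu : IsSemialgebraicFunOn ℚ G u) (hq : IsSemialgebraicFunOn ℚ G q) (n : ℕ)
    (hu0 : ∀ y ∈ G, 0 ≤ u y) (hint : IntegrableOn (fun y => q y * Gn n (u y)) G)
    (hqa : IntegrableOn (fun y => q y * Real.arctan (u y)) G) : KZ.IntegralRep (m + 1) where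
  domain := KZlog.band G (fun _ => 0) u
  integrand := fun z => q (Fin.init z) * qk n (z (Fin.last m))
  isSemialgebraic_domain := KZlog.isSemialgebraic_band
    ((isSemialgebraicFunOn_ratCast hG 0).congr fun _ _ => by simp) hu
  isSemialgebraicFunOn_integrand := by
    have hbsa : IsSemialgebraic ℚ (KZlog.band G (fun _ => (0:ℝ)) u) :=
      KZlog.isSemialgebraic_band ((isSemialgebraicFunOn_ratCast hG 0).congr fun _ _ => by simp) hu
    exact (hq.comp_init.mono (fun z hz => hz.1) hbsa).mul_holds
      (sa_qk hbsa (Literature.NumberTheory.Transcendental.isSemialgebraicFunOn_apply hbsa (Fin.last m)) n)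
  integrableOn := integrableOn_polyKernel_band hG hu hq n hu0 hint hqa

/-- **Kernel division as a relation**: `[S; p g_n] − [S; p q_n] − [S; p·(−1)^n/(1+s²)] ∈ relations` (KZ rule 1b). -/
theorem circ_kernel_split {p : (Fin 1 → ℝ) → ℝ} (n : ℕ) (A B₁ B₂ : KZ.IntegralRep 2)
    (h₁ : B₁.domain = A.domain) (h₂ : B₂.domain = A.domain)
    (hA : EqOn A.integrand (fun z => p (Fin.init z) * gk n (z (Fin.last 1))) A.domain)
    (hB₁ : EqOn B₁.integrand (fun z => p (Fin.init z) * qk n (z (Fin.last 1))) A.domain)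
    (hB₂ : EqOn B₂.integrand (fun z => p (Fin.init z) * ((-1) ^ n / (1 + z (Fin.last 1) ^ 2))) A.domain) :
    KZ.of A - KZ.of B₁ - KZ.of B₂ ∈ KZ.relations := by
  refine KZ.integrandAddRel_subset_relations ⟨2, A, B₁, B₂, h₁, h₂, fun z hz => ?_, rfl⟩
  rw [Pi.add_apply, hA hz, hB₁ hz, hB₂ hz]
  show p (Fin.init z) * gk n (z (Fin.last 1)) =
    p (Fin.init z) * qk n (z (Fin.last 1)) + p (Fin.init z) * ((-1) ^ n / (1 + z (Fin.last 1) ^ 2))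
  rw [gk_eq]
  ring

/-- **KZ rule 3 in `s` for the polynomial band (PROVED)**: `[band T 0 u; p(x) q_n(s)] − [T; p·Q_n(u)] ∈ relations`. -/
theorem poly_unfold {T : Set (Fin 1 → ℝ)} (_hT : IsSemialgebraic ℚ T) (n : ℕ) {p u : (Fin 1 → ℝ) → ℝ}
    (hp : IsSemialgebraicFunOn ℚ T p) (hu : IsSemialgebraicFunOn ℚ T u) (hu0 : ∀ x ∈ T, 0 ≤ u x)
    (B : KZ.IntegralRep 2) (hBd : B.domain = KZlog.band T (fun _ => 0) u)
    (hBi : EqOn B.integrand (fun z => p (Fin.init z) * qk n (z (Fin.last 1))) B.domain)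
    (R : KZ.IntegralRep 1) (hRd : R.domain = T) (hRi : EqOn R.integrand (fun x => p x * Qk n (u x)) T) :
    KZ.of B - KZ.of R ∈ KZ.relations := by
  set F : (Fin 2 → ℝ) → ℝ := fun z => p (Fin.init z) * Qk n (z (Fin.last 1)) with hF
  have hB1 : B.domain ⊆ {z : Fin 2 → ℝ | Fin.init z ∈ T} := fun z hz => by rw [hBd] at hz; exact hz.1
  have hF_sa : IsSemialgebraicFunOn ℚ B.domain F :=
    (hp.comp_init.mono hB1 B.isSemialgebraic_domain).mul_holds
      (sa_Qk B.isSemialgebraic_domain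
        (Literature.NumberTheory.Transcendental.isSemialgebraicFunOn_apply B.isSemialgebraic_domain (Fin.last 1)) n)
  have hFsnoc : ∀ (x : Fin 1 → ℝ) (t : ℝ), F (Fin.snoc x t) = p x * Qk n t := by
    intro x t; simp only [hF, Fin.init_snoc, Fin.snoc_last]
  have h0 : IsSemialgebraicFunOn ℚ R.domain (fun _ : Fin 1 → ℝ => (0:ℝ)) :=
    (isSemialgebraicFunOn_ratCast R.isSemialgebraic_domain 0).congr fun _ _ => by simp
  refine KZ.newtonLeibnizRel_subset_relations ⟨1, B, R, fun _ => 0, u, F, hF_sa, h0, hRd ▸ hu,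
    fun x hx => hu0 x (hRd ▸ hx), ?_, fun x hx => ?_, fun x hx t ht => ?_, fun x hx => ?_, rfl⟩
  · rw [hBd, hRd]; rfl
  · have : (fun t : ℝ => F (Fin.snoc x t)) = fun t => p x * Qk n t := funext (hFsnoc x)
    rw [this]
    exact (continuous_const.mul (continuous_Qk n)).continuousOn
  · have hxT : x ∈ T := hRd ▸ hx
    have hmem : (Fin.snoc x t : Fin 2 → ℝ) ∈ B.domain := by
      rw [hBd]; exact ⟨by rw [Fin.init_snoc]; exact hxT, by rw [Fin.snoc_last]; exact ht.1.le,
        by rw [Fin.snoc_last, Fin.init_snoc]; exact ht.2.le⟩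
    have : (fun s : ℝ => F (Fin.snoc x s)) = fun s => p x * Qk n s := funext (hFsnoc x)
    rw [this, hBi hmem]
    simp only [Fin.init_snoc, Fin.snoc_last]
    exact (hasDerivAt_Qk n t).const_mul (p x)
  · rw [hRi (hRd ▸ hx), hFsnoc, hFsnoc, Qk_zero_right, mul_zero, sub_zero]

end AngleFold
end Summit.KontsevichZagierPeriods.RootDecompRelativeModAbsolute.Rung30571.RegularisedLogLayer.CylLog.Leaf.G13
end
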